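import Mathlib.CategoryTheory.PUnit
import Mathlib.CategoryTheory.Discrete.Basic
import Mathlib.Data.Nat.Nth
import Mathlib.NumberTheory.PrimeCounting
import Literature.AlgebraicGeometry.Frobenioids.DivisorMonoidCategoryTheoreticity
import HarnessLib

/-!
# Frobenioids I, Corollary 4.11 (i), (ii) AS TYPED over the data-only operations interface: the
# universal closures are false — kernel `¬ ∀` (FACT-LIST rows F-1025, F-1026; schema / R5)

Mochizuki, *The geometry of Frobenioids I: the general theory*, Kyushu J. Math. **62** (2008)
293–400, Cor. 4.11 (i), (ii), kurims text p. 91 [cite: MochizukiFrdI2008, Cor. 4.11 (ii) p.91].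

PROOF-ONLY companion (no definitions, no instances) of the statement file
`DivisorMonoidCategoryTheoreticity.lean` (seat abc-iut-L1-t3), cell abc-iut, F fact-proving wave, seat
abc-iut-f-032, FACT-LIST rows **F-1025** `PreFrobenioidData.Cor411i` and **F-1026**
`PreFrobenioidData.Cor411ii` (class `preparatory`, kernel_closedness `parametrised`).

Both rows are SCHEMATA over the data-only interface `S_i : PreFrobenioidData C_i D_i` (the operations
`(Base, Div, deg_Fr)` of Def. 1.1 (iv), NOT the Frobenioid axioms of Def. 1.3) and, for (i), over a FREE
functor `Ψistr : C₁^istr ⥤ C₂^istr` (print: THE restriction of `Ψ`). The statement file itself warns that "a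
universally quantified data-only interface is refutable by junk instances". This file records the kernel
refutations of the universal closures:

* the DEGENERATE OPERATIONS on the one-object category `C = B(N_{≥1})` (`SingleObj ℕ+`; `deg_Fr = id`,
  `Div = 0`, `Φ ≡ ℤ_{≥0}` with identity pull-backs) over any base all of whose arrows are invertible and
  whose Hom-sets are subsingletons (`Discrete PUnit`, `Discrete Bool`) satisfy the typed hypotheses
  `Cor411Setting` — Div-slim bases of FSM-type, standard type (the one object is isotropic, and is not an
  iso-subanchor: its irreducible arrows are the primes, pairwise non-isomorphic under it, so it is no anchor),
  `HypB` vacuous (not group-like) — `cor411Setting_of_degenerate`;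
* `not_forall_cor411ii` — over the bases `Discrete PUnit`, `Discrete Bool` no `Ψ^Base` exists (no
  equivalence `PUnit ≃ Bool`);
* `not_forall_cor411i` — for the junk CONSTANT `Ψistr` every `Ψ^un-tr` `1`-commuting with it kills all
  arrows of `C^un-tr = C`, so it is no equivalence.

The forms print asserts and the tree PROVES are the instances at THE Frobenioids (cited, not restated):
`PreFrobenioid.cor411i_ofFunctor_of_isOfFSMType` (seat abc-iut-L1-t14), `FrdI.Cor411iRestrict` /
`FrdI.cor411iRestrict_of_facts` (`Cor411Sub.lean`); `PreFrobenioid.cor411ii_ofFunctor_of_isOfFSMType` (seat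
abc-iut-L1-d6), `cor411ii_arith` (arithmetic Frobenioids, seat abc-iut-L1-d1), and the 0-ary fact
`FrdI.Cor411ii` (F-0715). So F-1025/F-1026 are admissible AT NAMED INSTANCES ONLY. Bookkeeping about the
typing; nothing here bears on [IUTchIII] Cor. 3.12 or takes a side; a refuted closure is a statement about
the schema, not about the paper.
-/

namespace Literature.AlgebraicGeometry.Frobenioids

open CategoryTheory

namespace PreFrobenioidData

namespace CorSchemaNegative

/-! ### The one-object category `B(N_{≥1})`: isomorphisms, irreducible arrows, no anchors -/

/-- In `B(N_{≥1})` an invertible arrow is `1`. [cite: MochizukiFrdI2008, §0 p.14] -/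
theorem eq_one_of_isIso {x y : SingleObj ℕ+} (φ : x ⟶ y) [IsIso φ] : (show ℕ+ from φ) = 1 := by
  have h1 : (show ℕ+ from inv φ) * (show ℕ+ from φ) = 1 := IsIso.hom_inv_id φ
  have h2 : ((show ℕ+ from inv φ) : ℕ) * ((show ℕ+ from φ) : ℕ) = 1 := by
    rw [← PNat.mul_coe, h1, PNat.one_coe]
  exact PNat.coe_eq_one_iff.mp (Nat.eq_one_of_mul_eq_one_left h2)

/-- In `B(N_{≥1})` the arrow `1` is invertible. [cite: MochizukiFrdI2008, §0 p.14] -/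
theorem isIso_of_eq_one {x y : SingleObj ℕ+} (φ : x ⟶ y) (h : (show ℕ+ from φ) = 1) : IsIso φ :=
  ⟨⟨show ℕ+ from 1, by
    change (1 : ℕ+) * (show ℕ+ from φ) = 1
    rw [h, mul_one], by
    change (show ℕ+ from φ) * 1 = 1
    rw [h, mul_one]⟩⟩

/-- A prime `p`, as an arrow of `B(N_{≥1})`, is irreducible. [cite: MochizukiFrdI2008, §0 p.17] -/
theorem isIrreducibleHom_of_prime {x y : SingleObj ℕ+} (φ : x ⟶ y) (hp : ((show ℕ+ from φ) : ℕ).Prime) :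
    IsIrreducibleHom φ := by
  refine ⟨fun h => hp.ne_one ?_, fun X β α hβα => ?_⟩
  · rw [eq_one_of_isIso φ, PNat.one_coe]
  · have hβα' : (show ℕ+ from α) * (show ℕ+ from β) = (show ℕ+ from φ) := hβα
    have hd : ((show ℕ+ from α) : ℕ) ∣ ((show ℕ+ from φ) : ℕ) :=
      ⟨(show ℕ+ from β), by rw [← PNat.mul_coe, hβα']⟩
    rcases (Nat.dvd_prime hp).mp hd with h1 | h2
    · exact Or.inl (isIso_of_eq_one α (PNat.coe_eq_one_iff.mp h1))
    · refine Or.inr (isIso_of_eq_one β (PNat.coe_eq_one_iff.mp ?_))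
      have h3 : ((show ℕ+ from α) : ℕ) * ((show ℕ+ from β) : ℕ) = ((show ℕ+ from φ) : ℕ) * 1 := by
        rw [← PNat.mul_coe, hβα', mul_one]
      rw [h2] at h3
      exact Nat.eq_of_mul_eq_mul_left hp.pos h3

/-- No object of `B(N_{≥1})` is an anchor: the primes give infinitely many pairwise non-isomorphic
irreducible arrows out of it. [cite: MochizukiFrdI2008, §0 p.18] -/
theorem not_isAnchor (A : SingleObj ℕ+) : ¬ IsAnchor A := by
  intro hfin
  let P : ℕ → ℕ+ := fun n => ⟨Nat.nth Nat.Prime n, (Nat.prime_nth_prime n).pos⟩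
  have hP : ∀ n, ((P n : ℕ+) : ℕ).Prime := fun n => Nat.prime_nth_prime n
  let fr : ℕ → (A ⟶ A) := fun n => (P n : ℕ+)
  let g : ℕ → Quotient (isIsomorphicSetoid (Under A)) := fun n => Quotient.mk _ (Under.mk (fr n))
  have hg : Function.Injective g := by
    intro m n hmn
    obtain ⟨e⟩ := Quotient.exact hmn
    have w : (show ℕ+ from e.hom.right) * P m = P n := Under.w e.hom
    haveI : IsIso e.hom.right := Iso.isIso_hom ((Under.forget A).mapIso e)
    rw [eq_one_of_isIso e.hom.right, one_mul] at w
    exact Nat.nth_injective Nat.infinite_setOf_prime (congrArg (fun k : ℕ+ => (k : ℕ)) w)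
  refine Set.infinite_of_injective_forall_mem hg (fun n => ?_) hfin
  exact ⟨Under.mk (fr n), isIrreducibleHom_of_prime _ (hP n), rfl⟩

/-- Hence no object of `B(N_{≥1})` is an iso-subanchor (there are no subanchors).
[cite: MochizukiFrdI2008, §0 p.18] -/
theorem not_isIsoSubanchor (A : SingleObj ℕ+) : ¬ IsIsoSubanchor A := by
  rintro ⟨B, -, -, ⟨B', hB', -⟩, -⟩
  exact not_isAnchor B' hB'

/-! ### Degenerate operations on `B(N_{≥1})`: `deg_Fr = id`, `Div = 0` -/

section Degenerate

variable {D : Type} [Category.{0} D] (S : PreFrobenioidData.{0} (SingleObj ℕ+) D)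
  (hdeg : ∀ {x y : SingleObj ℕ+} (φ : x ⟶ y), S.degFr φ = φ)
  (hdiv : ∀ {x y : SingleObj ℕ+} (φ : x ⟶ y), S.div φ = 1)
  (hiso : ∀ {X Y : D} (f : X ⟶ Y), IsIso f)

include hdeg in
/-- Linear = degree `1` = the identity. [cite: MochizukiFrdI2008, Def. 1.2 (i) p.21] -/
theorem isLinear_iff {x y : SingleObj ℕ+} (φ : x ⟶ y) : S.IsLinear φ ↔ (show ℕ+ from φ) = 1 := by
  unfold IsLinear
  rw [hdeg]

include hdeg in
/-- A pre-step of the degenerate operations is invertible. [cite: MochizukiFrdI2008, Def. 1.2 (iii) p.22] -/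
theorem isIso_of_isPreStep {x y : SingleObj ℕ+} (φ : x ⟶ y) (h : S.IsPreStep φ) : IsIso φ :=
  isIso_of_eq_one φ ((isLinear_iff S hdeg φ).mp h.1)

include hdeg in
/-- Every object is isotropic. [cite: MochizukiFrdI2008, Def. 1.2 (iv) p.23] -/
theorem isIsotropic (A : SingleObj ℕ+) : S.IsIsotropic A :=
  fun _ φ hφ => isIso_of_isPreStep S hdeg φ hφ.1

include hdeg in
/-- Every arrow is co-angular (an isometric pre-step is invertible).
[cite: MochizukiFrdI2008, Def. 1.2 (iii) p.22] -/
theorem isCoAngular {x y : SingleObj ℕ+} (φ : x ⟶ y) : S.IsCoAngular φ :=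
  fun _ _ _ β _ _ _ hβ _ => isIso_of_isPreStep S hdeg β hβ.1

include hdeg hdiv hiso in
/-- Every arrow is of Frobenius type. [cite: MochizukiFrdI2008, Def. 1.2 (iii) p.22] -/
theorem isFrobeniusType {x y : SingleObj ℕ+} (φ : x ⟶ y) : S.IsFrobeniusType φ :=
  ⟨⟨isCoAngular S hdeg φ, hdiv φ⟩, hiso _⟩

include hdeg hdiv hiso in
/-- The degenerate operations over a base all of whose arrows are invertible, whose divisor monoid at the
(base of the) object is non-trivial and whose pull-backs along endomorphisms are identities, are of standard
type (Def. 3.1 (i)): quasi-isotropic (isotropic, no iso-subanchors), Frobenius-isotropic, not group-like,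
Frobenius-normalized (`O^▷ = {1}`), base of FSM-type, `Φ` non-dilating.
[cite: MochizukiFrdI2008, Def. 3.1 (i) p.56] -/
theorem isOfStandardType (hM : ∀ A : SingleObj ℕ+, ∃ m : S.Mon (S.base.obj A), m ≠ 1)
    (hpull : ∀ (X : D) (f : X ⟶ X) (m : S.Mon X), S.pull f m = m) : S.IsOfStandardType where
  quasiIsotropic := ⟨fun A => ⟨fun h => (h (isIsotropic S hdeg A)).elim,
    fun h => (not_isIsoSubanchor A h).elim⟩⟩
  frobeniusIsotropic := ⟨fun A => ⟨A, 𝟙 A, isFrobeniusType S hdeg hdiv hiso _, isIsotropic S hdeg A⟩⟩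
  frobeniusCompact_of_groupLike := fun hG => by
    obtain ⟨m, hm⟩ := hM (SingleObj.star ℕ+)
    exact (hm (hG.obj _ m)).elim
  frobeniusNormalized := ⟨fun A φ _ α hα => by
    have hα1 : (show ℕ+ from α) = 1 := (isLinear_iff S hdeg α).mp hα.2
    have hα2 : α = 1 := hα1
    rw [hα2, one_pow, one_mul, mul_one]⟩
  fsmff := (⟨fun f _ => hiso f⟩ : IsOfFSMType D).isOfFSMFFType
  nonDilating := ⟨fun X f _ a => by
    obtain ⟨m, rfl⟩ := Associates.mk_surjective a
    rw [associatesMap_mk, hpull]⟩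

/-- … and not of group-like type. [cite: MochizukiFrdI2008, Def. 1.2 (v) p.23] -/
theorem not_isOfGroupLikeType (hM : ∀ A : SingleObj ℕ+, ∃ m : S.Mon (S.base.obj A), m ≠ 1) :
    ¬ S.IsOfGroupLikeType := fun hG => by
  obtain ⟨m, hm⟩ := hM (SingleObj.star ℕ+)
  exact hm (hG.obj _ m)

/-- Over a base whose Hom-sets are subsingletons, any operations are Div-slim (the automorphism groups of
the forgetful functors `D_A → D` are trivial). [cite: MochizukiFrdI2008, Def. 4.5 (iv) p.86] -/
theorem isDivSlim_of_subsingleton {C : Type} [Category.{0} C] (T : PreFrobenioidData.{0} C D)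
    (hsub : ∀ X Y : D, Subsingleton (X ⟶ Y)) : T.IsDivSlim :=
  ⟨fun A α _ => by
    ext B
    exact @Subsingleton.elim _ (hsub _ _) _ _⟩

end Degenerate

/-- The typed hypotheses `Cor411Setting` HOLD for two degenerate operations on `B(N_{≥1})` over bases with
invertible arrows and subsingleton Hom-sets, and any self-equivalence `Ψ`.
[cite: MochizukiFrdI2008, Cor. 4.11 p.91] -/
theorem cor411Setting_of_degenerate {D₁ : Type} [Category.{0} D₁] {D₂ : Type} [Category.{0} D₂]
    (S₁ : PreFrobenioidData.{0} (SingleObj ℕ+) D₁) (S₂ : PreFrobenioidData.{0} (SingleObj ℕ+) D₂)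
    (Ψ : SingleObj ℕ+ ≌ SingleObj ℕ+)
    (hdeg₁ : ∀ {x y : SingleObj ℕ+} (φ : x ⟶ y), S₁.degFr φ = φ)
    (hdiv₁ : ∀ {x y : SingleObj ℕ+} (φ : x ⟶ y), S₁.div φ = 1)
    (hM₁ : ∀ A : SingleObj ℕ+, ∃ m : S₁.Mon (S₁.base.obj A), m ≠ 1)
    (hpull₁ : ∀ (X : D₁) (f : X ⟶ X) (m : S₁.Mon X), S₁.pull f m = m)
    (hiso₁ : ∀ {X Y : D₁} (f : X ⟶ Y), IsIso f) (hsub₁ : ∀ X Y : D₁, Subsingleton (X ⟶ Y))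
    (hdeg₂ : ∀ {x y : SingleObj ℕ+} (φ : x ⟶ y), S₂.degFr φ = φ)
    (hdiv₂ : ∀ {x y : SingleObj ℕ+} (φ : x ⟶ y), S₂.div φ = 1)
    (hM₂ : ∀ A : SingleObj ℕ+, ∃ m : S₂.Mon (S₂.base.obj A), m ≠ 1)
    (hpull₂ : ∀ (X : D₂) (f : X ⟶ X) (m : S₂.Mon X), S₂.pull f m = m)
    (hiso₂ : ∀ {X Y : D₂} (f : X ⟶ Y), IsIso f) (hsub₂ : ∀ X Y : D₂, Subsingleton (X ⟶ Y)) :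
    Cor411Setting S₁ S₂ Ψ where
  divSlim := ⟨isDivSlim_of_subsingleton S₁ hsub₁, isDivSlim_of_subsingleton S₂ hsub₂⟩
  standard := ⟨isOfStandardType S₁ hdeg₁ hdiv₁ hiso₁ hM₁ hpull₁,
    isOfStandardType S₂ hdeg₂ hdiv₂ hiso₂ hM₂ hpull₂⟩
  hypB := fun hG _ => (not_isOfGroupLikeType S₁ hM₁ hG).elim

/-- Degenerate operations on `B(N_{≥1})` EXIST over every (nonempty) base: base functor constant at
`X₀`, `Φ ≡ ℤ_{≥0}` with identity pull-backs, `Div = 0`, `deg_Fr = id`.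
[cite: MochizukiFrdI2008, Def. 1.1 (iv) p.20] -/
theorem exists_degenerate {D : Type} [Category.{0} D] (X₀ : D) :
    ∃ S : PreFrobenioidData.{0} (SingleObj ℕ+) D,
      (∀ {x y : SingleObj ℕ+} (φ : x ⟶ y), S.degFr φ = φ) ∧
      (∀ {x y : SingleObj ℕ+} (φ : x ⟶ y), S.div φ = 1) ∧
      (∀ A : SingleObj ℕ+, ∃ m : S.Mon (S.base.obj A), m ≠ 1) ∧
      (∀ (X : D) (f : X ⟶ X) (m : S.Mon X), S.pull f m = m) :=
  ⟨{ base := (Functor.const _).obj X₀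
     Mon := fun _ => Multiplicative ℕ
     pull := fun _ => MonoidHom.id _
     pull_id := fun _ _ => rfl
     pull_comp := fun _ _ _ => rfl
     div := fun _ => 1
     degFr := fun φ => φ
     div_id := fun _ => rfl
     div_comp := fun _ _ => by simp
     degFr_id := fun _ => rfl
     degFr_comp := fun ψ φ => mul_comm (show ℕ+ from φ) (show ℕ+ from ψ) },
    fun _ => rfl, fun _ => rfl,
    fun _ => ⟨Multiplicative.ofAdd (1 : ℕ), fun h => by
      change Multiplicative.ofAdd (1 : ℕ) = (1 : Multiplicative ℕ) at h
      exact one_ne_zero (Multiplicative.ofAdd.injective (h.trans ofAdd_zero.symm))⟩,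
    fun _ _ _ => rfl⟩

end CorSchemaNegative

open CorSchemaNegative

/-! ### F-1026: the universal closure of `Cor411ii` is false -/

/-- **F-1026 (FACT-LIST), schema negative.** The universal closure of the typed Cor. 4.11 (ii)
`PreFrobenioidData.Cor411ii` over the data-only operations interface is false: for the degenerate operations
on `B(N_{≥1})` over the bases `Discrete PUnit` and `Discrete Bool` (identity self-equivalence `Ψ`) the
hypotheses `Cor411Setting` hold, but there is no `Ψ^Base : Discrete PUnit ⥤ Discrete Bool` which is an
equivalence. The printed statement is the instance at Frobenioids, PROVED in the tree
(`PreFrobenioid.cor411ii_ofFunctor_of_isOfFSMType`, `cor411ii_arith`; 0-ary form `FrdI.Cor411ii`).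
[cite: MochizukiFrdI2008, Cor. 4.11 (ii) p.91] -/
theorem not_forall_cor411ii :
    ¬ ∀ (C₁ : Type) [Category.{0} C₁] (D₁ : Type) [Category.{0} D₁]
        (C₂ : Type) [Category.{0} C₂] (D₂ : Type) [Category.{0} D₂]
        (S₁ : PreFrobenioidData.{0} C₁ D₁) (S₂ : PreFrobenioidData.{0} C₂ D₂) (Ψ : C₁ ≌ C₂),
        S₁.Cor411ii S₂ Ψ := by
  intro h
  obtain ⟨S₁, hdeg₁, hdiv₁, hM₁, hpull₁⟩ := exists_degenerate (D := Discrete PUnit.{1}) ⟨⟨⟩⟩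
  obtain ⟨S₂, hdeg₂, hdiv₂, hM₂, hpull₂⟩ := exists_degenerate (D := Discrete Bool) ⟨true⟩
  obtain ⟨ΨBase, ⟨hE, -, -⟩, -⟩ := h _ _ _ _ S₁ S₂ CategoryTheory.Equivalence.refl
    (cor411Setting_of_degenerate S₁ S₂ _ hdeg₁ hdiv₁ hM₁ hpull₁ (fun f => inferInstance)
      (fun X Y => inferInstance) hdeg₂ hdiv₂ hM₂ hpull₂ (fun f => inferInstance) (fun X Y => inferInstance))
  haveI := hE
  have e : PUnit.{1} ≃ Bool := Discrete.equivOfEquivalence ΨBase.asEquivalence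
  exact absurd (e.symm.injective (Subsingleton.elim (e.symm true) (e.symm false))) (by decide)

/-! ### F-1025: the universal closure of `Cor411i` is false -/

/-- Unit-equivalent arrows of `C^istr` are EQUAL for the degenerate operations (`O^× = {1}`), so the inclusion
`C^istr → C` factors through `C^un-tr`. [cite: MochizukiFrdI2008, Def. 3.1 (iv) p.57] -/
theorem CorSchemaNegative.eq_of_unitEquiv {D : Type} [Category.{0} D]
    (S : PreFrobenioidData.{0} (SingleObj ℕ+) D)
    (hdeg : ∀ {x y : SingleObj ℕ+} (φ : x ⟶ y), S.degFr φ = φ)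
    (X Y : S.Istr) (f₁ f₂ : X ⟶ Y) (h : S.UnitEquiv f₁ f₂) : S.istrι.map f₁ = S.istrι.map f₂ := by
  obtain ⟨Z, γ, β, δ, hδ, rfl, rfl⟩ := h
  have hδ1 : (show ℕ+ from δ.hom) = 1 := (isLinear_iff S hdeg δ.hom).mp hδ.2
  have hδ2 : δ.hom = 𝟙 Z.obj := hδ1
  have : (ObjectProperty.homMk δ.hom : Z ⟶ Z) = 𝟙 Z := by ext; exact hδ2
  rw [this, Category.id_comp]

/-- **F-1025 (FACT-LIST), schema negative.** The universal closure of the typed Cor. 4.11 (i)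
`PreFrobenioidData.Cor411i` — quantified over a FREE functor `Ψistr : C₁^istr ⥤ C₂^istr` — is false: for the
degenerate operations on `C = B(N_{≥1})` over `Discrete PUnit` (identity `Ψ`; `Cor411Setting` holds) and the
CONSTANT junk `Ψistr`, any `Ψ^un-tr` `1`-commuting with `Ψistr` over `C^istr → C^un-tr` kills every arrow of
`C^un-tr`, and `C^un-tr → C` separates `2 ≠ 1`, so `Ψ^un-tr` is not faithful, hence no equivalence. The printed
statement (for THE restriction `Ψ^istr` of `Ψ`) is PROVED in the tree at Frobenioids
(`PreFrobenioid.cor411i_ofFunctor_of_isOfFSMType`; 0-ary form `FrdI.Cor411iRestrict`).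
[cite: MochizukiFrdI2008, Cor. 4.11 (i) p.91] -/
theorem not_forall_cor411i :
    ¬ ∀ (C₁ : Type) [Category.{0} C₁] (D₁ : Type) [Category.{0} D₁]
        (C₂ : Type) [Category.{0} C₂] (D₂ : Type) [Category.{0} D₂]
        (S₁ : PreFrobenioidData.{0} C₁ D₁) (S₂ : PreFrobenioidData.{0} C₂ D₂) (Ψ : C₁ ≌ C₂)
        (Ψistr : S₁.Istr ⥤ S₂.Istr), S₁.Cor411i S₂ Ψ Ψistr := by
  intro h
  obtain ⟨S, hdeg, hdiv, hM, hpull⟩ := exists_degenerate (D := Discrete PUnit.{1}) ⟨⟨⟩⟩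
  let X₀ : S.Istr := ⟨SingleObj.star ℕ+, isIsotropic S hdeg _⟩
  obtain ⟨Ψuntr, ⟨hE, ⟨η⟩, -⟩, -, -⟩ := h _ _ _ _ S S CategoryTheory.Equivalence.refl
    ((Functor.const _).obj X₀)
    (cor411Setting_of_degenerate S S _ hdeg hdiv hM hpull (fun f => inferInstance)
      (fun X Y => inferInstance) hdeg hdiv hM hpull (fun f => inferInstance) (fun X Y => inferInstance))
  -- `Ψ^un-tr` kills every endomorphism of `X₀`
  have hkill : ∀ n : X₀ ⟶ X₀, Ψuntr.map (S.toUntr.map n) = 𝟙 _ := fun n => by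
    have hn := η.hom.naturality n
    have h1 : ((Functor.const S.Istr).obj X₀ ⋙ S.toUntr).map n = 𝟙 _ := S.toUntr.map_id X₀
    rw [h1, Category.id_comp] at hn
    exact (cancel_epi (η.hom.app X₀)).mp (hn.symm.trans (Category.comp_id _).symm)
  -- but `C^istr → C^un-tr → C` separates `2` from `1`
  let two : X₀ ⟶ X₀ := ObjectProperty.homMk (show SingleObj.star ℕ+ ⟶ SingleObj.star ℕ+ from (2 : ℕ+))
  have h21 : S.toUntr.map two = S.toUntr.map (𝟙 X₀) := by
    haveI := hE
    apply Ψuntr.map_injective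
    rw [hkill, hkill]
  have hL := congrArg (CategoryTheory.Quotient.lift S.UnitEquiv S.istrι (eq_of_unitEquiv S hdeg)).map h21
  rw [CategoryTheory.Quotient.lift_map_functor_map, CategoryTheory.Quotient.lift_map_functor_map,
    CategoryTheory.Functor.map_id] at hL
  have h2 : (2 : ℕ+) = 1 := hL
  exact absurd h2 (by decide)

end PreFrobenioidData

end Literature.AlgebraicGeometry.Frobenioids
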